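import Summits.BirchSwinnertonDyer.Rank1Residual.ManinAdditive.KummerCubeMonodromy
import Literature.NumberTheory.EllipticCurves.FormalExpTaylorUniformizationProofs
import Literature.NumberTheory.EllipticCurves.ModularSymbolsProofs
import Mathlib.Analysis.Complex.TaylorSeries
import Mathlib.Analysis.Analytic.OfScalars
import HarnessLib

/-!
# S1 prelims (1/2): Taylor series at `0` commute with composition; the `q`-germ of the Eichler integral; the local-parameter germs (definitions)
# (route `ManinLocalTwoThree`, crux C3 `ManinPrimeToThreeAtNine` stmt-BirchSwinnertonDyer-22968; cell bsd-f2-manin, an g37, MEMO-an §80.9)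

Towards leaf S1 `KummerCubeAnalyticDictionary` of `Rank1Residual/ManinAdditive/KummerCubeMonodromy.lean` (the formal ↔
analytic dictionary for the tangent-line Kummer cube function along the modular parametrisation):

* `taylorAt0 f` — the Taylor series of `f : ℂ → ℂ` at `0` as a formal power series (the tree's local notation `𝓣[f]` of
  `AndreCriterionAnalyticProofs`, as a definition so that its algebra (`taylor_mul`, `taylor_add`, …) applies);
* **`taylorAt0_comp`** — for germs `F`, `ε` analytic at `0` with `ε 0 = 0`: `𝓣[F ∘ ε] = 𝓣[F].subst 𝓣[ε]`, by induction on
  the coefficient index through `F = F 0 + z·dslope F 0` (`coeff_mul_of_coeff_lt_eq_zero`);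
* `exists_hasSum_taylorAt0` — Taylor's theorem on a small ball (`Complex.hasSum_taylorSeries_on_ball`), coefficient form;
* `qGerm f` — the Eichler integral as an analytic function of `q`: `ε(q) = Σ (aₙ/n) qⁿ` (`FormalMultilinearSeries.ofScalarsSum`),
  with positive radius (the series converges at `q(i)`, `hasSum_eichlerIntegral`), `ε(q(τ)) = E_f(τ)`, `ε(0) = 0`,
  `𝓣[ε] = Σ (aₙ/n) Xⁿ`, and — for a normalised form (`a₁ = 1`) — `ε(q) ∉ Λ` for `q` near `0`, `q ≠ 0`
  (`eventually_qGerm_notMem`); `exists_im_bound_of_eventually` converts `∀ᶠ q ∈ 𝓝[≠] 0` into `Im τ > B`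
  (`Function.Periodic.norm_qParam`).
* definitions only (landing delta, p2 gen 16: all DEFINITIONS of the S1 files are gathered in this one reviewed module):
  `locT` (`t = −x/y`), `locW` (`w = −1/y`), `locG` (`g = t²x`), `locKummer` (the tangent-line Kummer germ) along the
  uniformisation of `V/ℂ` by `L`, and the formal polynomial `formalKummer`; their Taylor series are computed in prelims (2/2).

HONEST FRAMING: a routine analytic leaf of a CONDITIONAL reduction; E-an-57, C3 `ManinPrimeToThreeAtNine`, Manin's `c = 1`
remain OPEN; nothing about BSD is proved.  PARTITION unchanged · beyond-print theorem: no · BSD is not proved by this.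
[cite: SilvermanAEC2009, IV.1 (formal group expansions; shape)] [cite: Bost2001AlgebraicLeaves, §3.4.1 (formal vs analytic leaves; shape)]
-/

set_option autoImplicit false
-- lint-debt: the directory name repeats the summit name (sibling precedent `ManinLocalTwoThreeKummerCubeSigmaLeaves.lean`)
set_option linter.dupNamespace false

noncomputable section

open Complex Filter Topology PowerSeries CongruenceSubgroup
open scoped PeriodPair UpperHalfPlane MatrixGroups ModularForm Nat Classical
open WeierstrassCurve Literature.NumberTheory.EllipticCurves Literature.NumberTheory.EllipticCurves.ModularForms
open Literature.NumberTheory.Transcendental.AndreCriterion UpperHalfPlane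
open Summit.BirchSwinnertonDyer.Rank1Residual.ManinAdditive.CuspidalKummer
open Summit.BirchSwinnertonDyer.Rank1Residual.ManinAdditive.CuspidalKummerThree

namespace Summit.BirchSwinnertonDyer.BirchSwinnertonDyer.Theorems.ManinLocalTwoThree.KummerCubeAnalytic

open Summit.BirchSwinnertonDyer.Rank1Residual.ManinAdditive.KummerCubeMonodromy

/-! #### Taylor series at `0` (the tree's local notation `𝓣[f]`, here a definition) -/

/-- The Taylor series at `0` of `f : ℂ → ℂ` as a formal power series (the tree's `𝓣[f]` of
`AndreCriterionAnalyticProofs`, as a definition). [folklore] -/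
def taylorAt0 (f : ℂ → ℂ) : PowerSeries ℂ :=
  PowerSeries.mk fun n => ((n ! : ℂ))⁻¹ * iteratedDeriv n f 0

/-- The `n`-th coefficient of `𝓣[f]` is `f⁽ⁿ⁾(0)/n!`. [folklore] -/
theorem coeff_taylorAt0 (f : ℂ → ℂ) (n : ℕ) :
    coeff n (taylorAt0 f) = ((n ! : ℂ))⁻¹ * iteratedDeriv n f 0 := by
  rw [taylorAt0, coeff_mk]

/-- The constant coefficient of `𝓣[f]` is `f 0`. [folklore] -/
theorem constantCoeff_taylorAt0 (f : ℂ → ℂ) : constantCoeff (taylorAt0 f) = f 0 :=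
  constantCoeff_taylor f

/-- `𝓣[id] = X`. [folklore] -/
theorem taylorAt0_id : taylorAt0 (fun z : ℂ => z) = X := by
  ext n
  rw [coeff_taylorAt0, coeff_X]
  rcases n with _ | _ | n
  · simp
  · simp
  · have h : iteratedDeriv (n + 2) (fun z : ℂ => z) 0 = 0 := by
      rw [show n + 2 = (n + 1) + 1 by ring, iteratedDeriv_succ']
      have hd : deriv (fun z : ℂ => z) = fun _ => (1 : ℂ) := by funext z; exact deriv_id z
      rw [hd, iteratedDeriv_const]
      simp
    rw [h]; simp

/-- **Taylor series commute with composition**: for germs `F`, `ε` analytic at `0` with `ε(0) = 0`,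
`𝓣[F ∘ ε] = 𝓣[F](𝓣[ε])` (formal substitution).  Proof by induction on the coefficient index via
`F = F(0) + z·F₁` (`dslope`). [folklore] -/
theorem taylorAt0_comp {F ε : ℂ → ℂ} (hF : AnalyticAt ℂ F 0) (hε : AnalyticAt ℂ ε 0) (h0 : ε 0 = 0) :
    taylorAt0 (F ∘ ε) = (taylorAt0 F).subst (taylorAt0 ε) := by
  have hT0 : constantCoeff (taylorAt0 ε) = 0 := by rw [constantCoeff_taylorAt0, h0]
  have hs : HasSubst (taylorAt0 ε) := HasSubst.of_constantCoeff_zero' hT0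
  -- the decomposition `F = F 0 + z · dslope F 0`
  have hdec : ∀ G : ℂ → ℂ, AnalyticAt ℂ G 0 →
      AnalyticAt ℂ (dslope G 0) 0 ∧ (∀ w, G w = G 0 + w * dslope G 0 w) := by
    intro G hG
    obtain ⟨p, hp⟩ := hG
    refine ⟨⟨_, hp.has_fpower_series_dslope_fslope⟩, fun w => ?_⟩
    have h := sub_smul_dslope G 0 w
    rw [sub_zero, smul_eq_mul] at h
    rw [h]; ring
  suffices key : ∀ n : ℕ, ∀ G : ℂ → ℂ, AnalyticAt ℂ G 0 → ∀ m ≤ n,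
      coeff m (taylorAt0 (G ∘ ε)) = coeff m ((taylorAt0 G).subst (taylorAt0 ε)) by
    ext m
    exact key m F hF m le_rfl
  intro n
  induction n with
  | zero =>
    intro G hG m hm
    obtain rfl : m = 0 := Nat.le_zero.mp hm
    rw [coeff_zero_eq_constantCoeff_apply, coeff_zero_eq_constantCoeff_apply, constantCoeff_taylorAt0,
      Literature.NumberTheory.EllipticCurves.constantCoeff_subst_of_constantCoeff_eq_zero hT0,
      constantCoeff_taylorAt0, Function.comp_apply, h0]
  | succ n ih =>
    intro G hG m hm
    obtain ⟨hG₁, hGw⟩ := hdec G hG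
    set G₁ := dslope G 0 with hG₁def
    -- `G ∘ ε = G 0 + ε · (G₁ ∘ ε)` and `G = G 0 + id · G₁`
    have hε0 : AnalyticAt ℂ ε 0 := hε
    have hG₁ε : AnalyticAt ℂ (G₁ ∘ ε) 0 := by
      have h' : AnalyticAt ℂ G₁ (ε 0) := by rw [h0]; exact hG₁
      exact h'.comp hε
    have hcomp : G ∘ ε = (fun _ => G 0) + ε * (G₁ ∘ ε) := by
      funext w
      simp only [Function.comp_apply, Pi.add_apply, Pi.mul_apply]
      exact hGw (ε w)
    have hself : G = (fun _ => G 0) + (fun z : ℂ => z) * G₁ := by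
      funext w
      simp only [Pi.add_apply, Pi.mul_apply]
      exact hGw w
    have hid : AnalyticAt ℂ (fun z : ℂ => z) 0 := analyticAt_id
    have hTcomp : taylorAt0 (G ∘ ε) = C (G 0) + taylorAt0 ε * taylorAt0 (G₁ ∘ ε) := by
      rw [hcomp]
      change (PowerSeries.mk fun n => ((n ! : ℂ))⁻¹ *
          iteratedDeriv n ((fun _ => G 0) + ε * (G₁ ∘ ε)) 0) = _
      rw [taylor_add analyticAt_const (hε0.mul hG₁ε), taylor_mul hε0 hG₁ε,
        Literature.NumberTheory.EllipticCurves.taylor_const]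
      rfl
    have hTself : taylorAt0 G = C (G 0) + X * taylorAt0 G₁ := by
      conv_lhs => rw [hself]
      change (PowerSeries.mk fun n => ((n ! : ℂ))⁻¹ *
          iteratedDeriv n ((fun _ => G 0) + (fun z : ℂ => z) * G₁) 0) = _
      rw [taylor_add analyticAt_const (hid.mul hG₁), taylor_mul hid hG₁,
        Literature.NumberTheory.EllipticCurves.taylor_const, ← taylorAt0_id]
      rfl
    have hTsubst : (taylorAt0 G).subst (taylorAt0 ε) =
        C (G 0) + taylorAt0 ε * (taylorAt0 G₁).subst (taylorAt0 ε) := by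
      rw [hTself, ← coe_substAlgHom hs, map_add, map_mul, substAlgHom_X hs,
        Literature.NumberTheory.EllipticCurves.substAlgHom_C hs]
    rw [hTcomp, hTsubst, map_add, map_add, add_right_inj]
    -- the two products agree in degree `m`, since the second factors agree below `m`
    have hS : ∀ m' < m, coeff m' (taylorAt0 (G₁ ∘ ε) - (taylorAt0 G₁).subst (taylorAt0 ε)) = 0 := by
      intro m' hm'
      rw [map_sub, sub_eq_zero]
      exact ih G₁ hG₁ m' (by omega)
    have h := coeff_mul_of_coeff_lt_eq_zero hS (taylorAt0 ε)
    rw [mul_sub, map_sub, hT0, zero_mul, sub_eq_zero] at h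
    exact h

/-- **Taylor's theorem on a ball, coefficient form**: an analytic germ at `0` is the sum of its Taylor
series on a small ball. [folklore] -/
theorem exists_hasSum_taylorAt0 {K : ℂ → ℂ} (hK : AnalyticAt ℂ K 0) :
    ∃ r : ℝ, 0 < r ∧ ∀ q : ℂ, ‖q‖ < r → HasSum (fun n : ℕ => coeff n (taylorAt0 K) * q ^ n) (K q) := by
  obtain ⟨r, hr, hKr⟩ := hK.exists_ball_analyticOnNhd
  refine ⟨r, hr, fun q hq => ?_⟩
  have hq' : q ∈ Metric.ball (0 : ℂ) r := by rwa [Metric.mem_ball, dist_zero_right]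
  have h := Complex.hasSum_taylorSeries_on_ball hKr.differentiableOn hq'
  have hfun : (fun n : ℕ => coeff n (taylorAt0 K) * q ^ n) =
      fun n : ℕ => ((n ! : ℂ))⁻¹ • (q - 0) ^ n • iteratedDeriv n K 0 := by
    funext n
    rw [coeff_taylorAt0, sub_zero, smul_eq_mul, smul_eq_mul]
    ring
  rw [hfun]
  exact h

/-! #### The `q`-germ of the Eichler integral -/

/-- The Eichler integral as a function of `q`: `ε(q) = Σ_{n ≥ 1} (aₙ/n) qⁿ`. [folklore] -/
def qGerm {M : ℕ} (f : CuspForm (Gamma0 M) 2) : ℂ → ℂ :=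
  FormalMultilinearSeries.ofScalarsSum (E := ℂ) fun n => cuspCoeff f n / n

/-- `ε(q(τ)) = E_f(τ)`: the `q`-germ evaluated at `q(τ)` is the Eichler integral (`hasSum_eichlerIntegral`). [folklore] -/
theorem qGerm_apply {M : ℕ} [NeZero M] (f : CuspForm (Gamma0 M) 2) (τ : ℍ) :
    qGerm f (Function.Periodic.qParam 1 (τ : ℂ)) = eichlerIntegral f τ := by
  rw [qGerm, FormalMultilinearSeries.ofScalars_sum_eq]
  simp only [smul_eq_mul]
  exact (hasSum_eichlerIntegral f τ).tsum_eq

/-- The `q`-series of the Eichler integral has positive radius (it converges at `q(i)`). [folklore] -/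
theorem radius_qGerm_pos {M : ℕ} [NeZero M] (f : CuspForm (Gamma0 M) 2) :
    0 < (FormalMultilinearSeries.ofScalars ℂ fun n => cuspCoeff f n / n).radius := by
  set q₀ : ℂ := Function.Periodic.qParam 1 ((UpperHalfPlane.I : ℍ) : ℂ) with hq₀
  have hq₀ne : q₀ ≠ 0 := by
    rw [← norm_pos_iff, hq₀, Function.Periodic.norm_qParam]; exact Real.exp_pos _
  have hsum := (hasSum_eichlerIntegral f UpperHalfPlane.I).summable
  obtain ⟨C, hC⟩ := (hsum.tendsto_atTop_zero.norm).bddAbove_range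
  have hle : ((‖q₀‖₊ : NNReal) : ENNReal) ≤
      (FormalMultilinearSeries.ofScalars ℂ fun n => cuspCoeff f n / n).radius := by
    refine FormalMultilinearSeries.le_radius_of_bound _ C fun n => ?_
    rw [FormalMultilinearSeries.ofScalars_norm, coe_nnnorm, ← norm_pow, ← norm_mul]
    exact hC ⟨n, rfl⟩
  refine lt_of_lt_of_le ?_ hle
  exact ENNReal.coe_pos.mpr (pos_iff_ne_zero.mpr (nnnorm_ne_zero_iff.mpr hq₀ne))

/-- The `q`-germ is the sum of its defining power series on the ball of its (positive) radius. [folklore] -/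
theorem hasFPowerSeriesOnBall_qGerm {M : ℕ} [NeZero M] (f : CuspForm (Gamma0 M) 2) :
    HasFPowerSeriesOnBall (qGerm f) (FormalMultilinearSeries.ofScalars ℂ fun n => cuspCoeff f n / n) 0
      (FormalMultilinearSeries.ofScalars ℂ fun n => cuspCoeff f n / n).radius :=
  (FormalMultilinearSeries.ofScalars ℂ fun n => cuspCoeff f n / n).hasFPowerSeriesOnBall (radius_qGerm_pos f)

/-- The `q`-germ is analytic at `0`. [folklore] -/
theorem analyticAt_qGerm {M : ℕ} [NeZero M] (f : CuspForm (Gamma0 M) 2) : AnalyticAt ℂ (qGerm f) 0 :=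
  (hasFPowerSeriesOnBall_qGerm f).analyticAt

/-- The Taylor series of `ε` is `Σ (aₙ/n) qⁿ`. [folklore] -/
theorem taylorAt0_qGerm {M : ℕ} [NeZero M] (f : CuspForm (Gamma0 M) 2) :
    taylorAt0 (qGerm f) = PowerSeries.mk fun n => cuspCoeff f n / n := by
  ext n
  rw [coeff_taylorAt0, coeff_mk, iteratedDeriv_eq_iteratedFDeriv,
    ← (hasFPowerSeriesOnBall_qGerm f).factorial_smul 1 n, FormalMultilinearSeries.ofScalars_apply_eq]
  simp only [one_pow, smul_eq_mul, mul_one, nsmul_eq_mul]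
  have hn : (n ! : ℂ) ≠ 0 := by exact_mod_cast Nat.factorial_ne_zero n
  field_simp

/-- `ε(0) = 0` (no constant term). [folklore] -/
theorem qGerm_zero {M : ℕ} [NeZero M] (f : CuspForm (Gamma0 M) 2) : qGerm f 0 = 0 := by
  have h := constantCoeff_taylorAt0 (qGerm f)
  rw [taylorAt0_qGerm, ← coeff_zero_eq_constantCoeff_apply, coeff_mk] at h
  rw [← h]; simp

/-- Near `q = 0` (punctured) the Eichler integral avoids any lattice and `q` is small: for a NEWFORM
(`a₁ = 1`, so `ε` has a simple zero at `0`). [folklore] -/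
theorem eventually_qGerm_notMem {M : ℕ} [NeZero M] (f : CuspForm (Gamma0 M) 2) (hf1 : cuspCoeff f 1 = 1)
    (L : PeriodPair) : ∀ᶠ q in 𝓝[≠] (0 : ℂ), qGerm f q ∉ L.lattice := by
  have hε := analyticAt_qGerm f
  -- `ε` is not identically zero near `0`
  have hne : ∀ᶠ q in 𝓝[≠] (0 : ℂ), qGerm f q ≠ 0 := by
    rcases hε.eventually_eq_zero_or_eventually_ne_zero with h | h
    · exfalso
      have hT : taylorAt0 (qGerm f) = taylorAt0 (fun _ => (0 : ℂ)) := taylor_congr h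
      have h1 := congrArg (coeff 1) hT
      rw [taylorAt0_qGerm, coeff_mk, hf1] at h1
      change (1 : ℂ) / ((1 : ℕ) : ℂ) = coeff 1 (taylorAt0 fun _ => (0 : ℂ)) at h1
      rw [show taylorAt0 (fun _ => (0 : ℂ)) = C (0 : ℂ) from
        Literature.NumberTheory.EllipticCurves.taylor_const 0] at h1
      simp at h1
    · exact h
  -- `ε(q) → 0`, and `Λ ∖ {0}` is closed
  have hΛ : ∀ᶠ w in 𝓝 (0 : ℂ), w ≠ 0 → w ∉ L.lattice :=
    eventually_nhdsWithin_iff.mp L.eventually_nhdsNE_notMem_lattice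
  have hcont : ContinuousAt (qGerm f) 0 := hε.continuousAt
  have h2 : ∀ᶠ q in 𝓝 (0 : ℂ), qGerm f q ≠ 0 → qGerm f q ∉ L.lattice := by
    have : Filter.Tendsto (qGerm f) (𝓝 0) (𝓝 0) := by simpa [qGerm_zero] using hcont.tendsto
    exact this.eventually hΛ
  filter_upwards [hne, mem_nhdsWithin_of_mem_nhds h2] with q h1q h2q
  exact h2q h1q

/-- From a punctured-neighbourhood statement in `q` to a statement for `Im τ` large. [folklore] -/
theorem exists_im_bound_of_eventually {P : ℂ → Prop} (hP : ∀ᶠ q in 𝓝[≠] (0 : ℂ), P q) :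
    ∃ B : ℝ, ∀ τ : ℍ, B < τ.im → P (Function.Periodic.qParam 1 (τ : ℂ)) := by
  obtain ⟨δ, hδ, hball⟩ : ∃ δ > 0, ∀ q : ℂ, 0 < ‖q‖ → ‖q‖ < δ → P q := by
    rw [eventually_nhdsWithin_iff, Metric.eventually_nhds_iff] at hP
    obtain ⟨δ, hδ, h⟩ := hP
    refine ⟨δ, hδ, fun q hq0 hqδ => h (by rwa [dist_zero_right]) ?_⟩
    exact norm_pos_iff.mp hq0
  refine ⟨-Real.log δ / (2 * Real.pi), fun τ hτ => hball _ ?_ ?_⟩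
  · rw [Function.Periodic.norm_qParam]; exact Real.exp_pos _
  · rw [Function.Periodic.norm_qParam, div_one]
    calc Real.exp (-2 * Real.pi * (τ : ℂ).im)
        < Real.exp (Real.log δ) := by
          apply Real.exp_lt_exp.mpr
          have hπ : 0 < 2 * Real.pi := by positivity
          have him : (τ : ℂ).im = τ.im := rfl
          rw [him]
          have := (div_lt_iff₀ hπ).mp hτ
          linarith
      _ = δ := Real.exp_log hδ
/-! #### The local-parameter germs (definitions only; their Taylor series are computed in
`Theorems/ManinLocalTwoThreeKummerCubeAnalyticLocalParam.lean`) -/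

/-- The local parameter `t = −x/y` along the uniformisation `(x, y) = (℘ − b₂/12, (℘' − a₁x − a₃)/2)` of
`V/ℂ` by `L` (extended by `0` on `Λ`; the tree's function of `taylor_localParam_eq_formalExp`). [folklore] -/
def locT (L : PeriodPair) (V : WeierstrassCurve ℂ) (z : ℂ) : ℂ :=
  if z ∈ L.lattice then 0 else
    -(℘[L] z - V.b₂ / 12) / ((℘'[L] z - V.a₁ * (℘[L] z - V.b₂ / 12) - V.a₃) / 2)

/-- `w = −1/y` along the uniformisation (extended by `0` on `Λ`). [folklore] -/
def locW (L : PeriodPair) (V : WeierstrassCurve ℂ) (z : ℂ) : ℂ :=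
  if z ∈ L.lattice then 0 else -1 / ((℘'[L] z - V.a₁ * (℘[L] z - V.b₂ / 12) - V.a₃) / 2)

/-- `g = t²·x` along the uniformisation (extended by `1` on `Λ`): the analytic germ whose Taylor series
is `z²x(z) = formalXMulSq` at `exp_V`. [folklore] -/
def locG (L : PeriodPair) (V : WeierstrassCurve ℂ) (z : ℂ) : ℂ :=
  if z ∈ L.lattice then 1 else locT L V z ^ 2 * (℘[L] z - V.b₂ / 12)

/-- The tangent-line Kummer germ in the uniformising variable:
`−g − Y₀t³ − α(g·t − X₀t³) = t³(y − Y₀ − α(x − X₀))`. [folklore] -/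
def locKummer (L : PeriodPair) (V : WeierstrassCurve ℂ) (α X₀ Y₀ : ℂ) (z : ℂ) : ℂ :=
  -locG L V z - Y₀ * locT L V z ^ 3 - α * (locG L V z * locT L V z - X₀ * locT L V z ^ 3)

/-- The formal tangent-line Kummer polynomial in `(X, formalXMulSq)`:
`−(X²x) − Y₀X³ − α((X²x)·X − X₀X³)`. [folklore] -/
def formalKummer (V : WeierstrassCurve ℂ) (α X₀ Y₀ : ℂ) : PowerSeries ℂ :=
  -V.formalXMulSq - C Y₀ * X ^ 3 - C α * (V.formalXMulSq * X - C X₀ * X ^ 3)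

end Summit.BirchSwinnertonDyer.BirchSwinnertonDyer.Theorems.ManinLocalTwoThree.KummerCubeAnalytic

end
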